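import Literature.Geometry.Riemannian.RoundSphere
import Literature.Geometry.Lorentzian.TangentialConnection
import HarnessLib

/-!
# The round sphere has constant curvature `1` and is Einstein: `Ric = (n - 1) g`
(topic `Geometry/Riemannian`; discharge of the named fact `ricci_roundMetric` of `RoundSphere.lean`)

Topping 2006, §1.2.1 asserts without proof that "for the round 'unit' sphere `(Sⁿ, g₀)`, we have
`Ric(g₀) = (n-1)g₀`". This file proves it for the round metric `roundMetric V` of
`RoundSphere.lean` (the metric induced on Mathlib's manifold `sphere (0 : V) 1`,
`dim V = n + 1`, by the inclusion `ι` into the inner product space `V`) and for EVERY torsion-free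
`g`-compatible covariant derivative `cov`, which is how the fact is vended
(`Literature.Geometry.Riemannian.ricci_roundMetric`). It is the first curvature computation of a
concrete curved metric in the tree; the route is the classical one through the ambient space
(Lee 2018, Ch. 5 and Ch. 8):

1. `mvfderiv_coe_cov_apply_sphere` — the Levi-Civita connection of the sphere is the projected
   ambient derivative, `dι(∇_v Y) = D_v(ι_* Y) - ⟪y, D_v(ι_* Y)⟫ y` (Lee 2018, Example 4.9 and
   Prop. 5.12 (b)), from the tangential Gauss formula
   `IsLeviCivita.inner_mvfderiv_cov_apply` of `Lorentzian/TangentialConnection.lean` and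
   Mathlib's `range_mfderiv_coe_sphere` (`dι(T_y Sⁿ) = (ℝ ∙ y)ᗮ`);
2. `inner_coe_mvfderiv_lift_sphere` — the normal component: `⟪y, D_v(ι_* Z)⟫ = -⟪dι v, ι_* Z⟫`
   (the shape operator of the unit sphere is `-Id` for the outward normal, Lee 2018,
   Example 8.25), by differentiating `⟪y, ι_* Z(y)⟫ = 0`;
3. `val_cov_cov_apply_sphere` — hence `ι_*(∇_Y Z) = D_Y(ι_* Z) + g(Y, Z) y` near `x`, and the
   second covariant derivative paired with a tangent vector is
   `g(∇_{X₀} ∇_Y Z, W₀) = ⟪D_{X₀} D_Y (ι_* Z), dι W₀⟫ + g(Y, Z) g(X₀, W₀)`;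
4. `curvature_roundMetric` — **`R(X, Y)Z = g(Y, Z)X - g(X, Z)Y`** (Lee 2018, Thm. 8.34 (b) with
   Prop. 8.36; the Gauss equation, Thm. 8.5, for this hypersurface): the curvature tensor
   (`CovariantDerivative.curvature`, convention `R(X,Y)Z = ∇_X ∇_Y Z - ∇_Y ∇_X Z - ∇_{[X,Y]} Z`)
   is evaluated on smooth local extensions by `curvature_apply_of_isLocallyContMDiff`
   (`CurvatureProofs.lean`), the bracket term is pushed to `V` by
   `mvfderiv_apply_mlieBracket_vec`, and the ambient second derivatives cancel;
5. `ricci_roundMetric_holds` — `Ric(X, Y) = tr (v ↦ R(v, X)Y) = n g(X,Y) - g(X,Y)`.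

Design: all identities are proved in `V` after applying `dι` (injective; Mathlib's
`mvfderiv`, written `dι[y]` below) and pairing with tangent vectors `dι W₀`, then transferred
back by nondegeneracy of `g`; no charts of the sphere are ever opened. Not here: sectional
curvature as a notion, spheres of other radii (use `RicciFlowScaling.lean`), the hyperbolic case.

## References

* [Topping2006] P. Topping, *Lectures on the Ricci flow*, LMS LNS 325, CUP 2006, §1.2.1.
* [Lee2018] J. M. Lee, *Introduction to Riemannian Manifolds*, 2nd ed., Springer 2018,
  Example 4.9, Prop. 5.12 (b), Example 8.25, Thm. 8.34 (b), Prop. 8.36.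
* [ONeill1983] B. O'Neill, *Semi-Riemannian geometry*, Academic Press 1983, Ch. 3, Def. 3.4.
-/

noncomputable section

open Bundle Set NormedSpace FiberBundle VectorField Metric Module
open scoped Manifold ContDiff Topology RealInnerProductSpace

namespace Literature.Geometry.Riemannian

open Lorentzian Lorentzian.PseudoRiemannianMetric

variable {V : Type*} [NormedAddCommGroup V] [InnerProductSpace ℝ V] {n : ℕ}
  [Fact (finrank ℝ V = n + 1)]

/-- `dι[y]`: the differential at `y` of the inclusion `ι : Sⁿ ↪ V`, as a map into `V`
(Mathlib's `mvfderiv`, definitionally `mfderiv`). Local notation. -/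
local notation "dι[" y "]" => mvfderiv (𝓡 n) (Subtype.val : sphere (0 : V) 1 → V) y

/-! ## The inclusion and its differential

The inclusion `ι : Sⁿ ↪ V` is `C^m` for every `m`: Mathlib's `contMDiff_coe_sphere`, used
directly below. -/

omit [Fact (finrank ℝ V = n + 1)] in
/-- The round metric is the inner product of the images under `dι`:
`g_y(v, w) = ⟪dι_y v, dι_y w⟫` (`roundMetric_apply`, restated with `mvfderiv`; O'Neill 1983,
Ch. 3, Def. 3.4: the metric of a semi-Riemannian submanifold is the pullback along the
inclusion). [cite: ONeill1983, Ch. 3, Def. 3.4 and p. 57] -/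
theorem roundMetric_val_eq_inner [Fact (finrank ℝ V = n + 1)] (y : sphere (0 : V) 1)
    (v w : TangentSpace (𝓡 n) y) :
    (roundMetric (n := n) V).val y v w = ⟪dι[y] v, dι[y] w⟫ :=
  roundMetric_apply y v w

/-- Tangent vectors of the sphere are orthogonal to the position vector: `⟪y, dι_y v⟫ = 0`
(Mathlib's `range_mfderiv_coe_sphere`: the range of `dι_y` is `(ℝ ∙ y)ᗮ`). [folklore] -/
theorem inner_coe_mvfderiv_coe_sphere (y : sphere (0 : V) 1) (v : TangentSpace (𝓡 n) y) :
    ⟪(y : V), dι[y] v⟫ = 0 := by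
  have h : (mfderiv (𝓡 n) 𝓘(ℝ, V) (Subtype.val : sphere (0 : V) 1 → V) y v : V) ∈
      (ℝ ∙ (y : V))ᗮ := by
    rw [← range_mfderiv_coe_sphere (n := n) y]
    exact LinearMap.mem_range_self _ v
  exact Submodule.mem_orthogonal_singleton_iff_inner_right.1 h

/-- Every vector orthogonal to `y` is a tangent vector of the sphere at `y`: `(ℝ ∙ y)ᗮ` is the
range of `dι_y` (Mathlib's `range_mfderiv_coe_sphere`). [folklore] -/
theorem exists_mvfderiv_coe_sphere_eq (y : sphere (0 : V) 1) {u : V}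
    (hu : ⟪(y : V), u⟫ = 0) : ∃ w : TangentSpace (𝓡 n) y, dι[y] w = u := by
  have h : u ∈ (ℝ ∙ (y : V))ᗮ := Submodule.mem_orthogonal_singleton_iff_inner_right.2 hu
  rw [← range_mfderiv_coe_sphere (n := n) y] at h
  obtain ⟨w, hw⟩ := h
  exact ⟨w, hw⟩

/-! ## The Levi-Civita connection of the sphere in the ambient space -/

/-- **The Levi-Civita connection of the round sphere is the projected ambient derivative.** For
any torsion-free covariant derivative `cov` compatible with the round metric, a vector field `Y`
of class `C²` at `y` and `v ∈ T_y Sⁿ`: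
`dι(∇_v Y) = D_v(ι_* Y) - ⟪y, D_v(ι_* Y)⟫ y`, the orthogonal projection onto
`dι(T_y Sⁿ) = y^⊥` of the derivative at `y` along `v` of `ι_* Y : y' ↦ dι_{y'}(Y y')`
(Lee 2018, Example 4.9 and Prop. 5.12 (b): `∇^⊤_X Y = π^⊤(∇̄_X Ỹ)` is the Levi-Civita
connection). From the tangential Gauss formula `IsLeviCivita.inner_mvfderiv_cov_apply`: both
sides lie in `(ℝ ∙ y)ᗮ = range dι_y` and have the same inner product with every `dι W₀`.
[cite: Lee2018, Prop. 5.12 (b) and Example 4.9] -/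
theorem mvfderiv_coe_cov_apply_sphere
    {cov : CovariantDerivative (𝓡 n) (EuclideanSpace ℝ (Fin n))
      (TangentSpace (𝓡 n) : sphere (0 : V) 1 → Type _)}
    (h : (roundMetric (n := n) V).IsLeviCivita cov) {y : sphere (0 : V) 1}
    {Y : Π y : sphere (0 : V) 1, TangentSpace (𝓡 n) y} (hY : CMDiffAt 2 (T% Y) y)
    (v : TangentSpace (𝓡 n) y) :
    dι[y] (cov Y y v) =
      mvfderiv (𝓡 n) (fun y' ↦ dι[y'] (Y y')) y v
        - ⟪(y : V), mvfderiv (𝓡 n) (fun y' ↦ dι[y'] (Y y')) y v⟫ • (y : V) := by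
  set u : V := mvfderiv (𝓡 n) (fun y' ↦ dι[y'] (Y y')) y v with hu
  set ℓ : V := dι[y] (cov Y y v) with hℓ
  have hyy : ⟪(y : V), (y : V)⟫ = 1 := by
    rw [real_inner_self_eq_norm_sq, norm_eq_of_mem_sphere, one_pow]
  -- both sides are orthogonal to `y`
  have hp : ⟪(y : V), u - ⟪(y : V), u⟫ • (y : V)⟫ = 0 := by
    rw [inner_sub_right, real_inner_smul_right, hyy, mul_one, sub_self]
  have hℓy : ⟪(y : V), ℓ⟫ = 0 := inner_coe_mvfderiv_coe_sphere y _
  -- hence so is their difference, which is then `dι W₀` for some `W₀`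
  obtain ⟨W₀, hW₀⟩ := exists_mvfderiv_coe_sphere_eq (n := n) y
    (u := ℓ - (u - ⟪(y : V), u⟫ • (y : V))) (by rw [inner_sub_right, hp, hℓy, sub_zero])
  -- the tangential Gauss formula, tested against `W₀`
  have hA := h.inner_mvfderiv_cov_apply contMDiff_coe_sphere
    (roundMetric_val_eq_inner (n := n)) hY v W₀
  rw [← hℓ, ← hu] at hA
  have hyW : ⟪(y : V), dι[y] W₀⟫ = 0 := inner_coe_mvfderiv_coe_sphere y W₀
  have h0 : ⟪ℓ - (u - ⟪(y : V), u⟫ • (y : V)), dι[y] W₀⟫ = 0 := by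
    rw [inner_sub_left, inner_sub_left, real_inner_smul_left, hyW, mul_zero, sub_zero, hA,
      sub_self]
  rw [hW₀, real_inner_self_eq_norm_sq, sq_eq_zero_iff, norm_eq_zero] at h0
  exact sub_eq_zero.1 h0

/-- **The normal component (shape operator of the unit sphere).** For a `V`-valued function `F`
on the sphere with `⟪y, F y⟫ = 0` everywhere (a lift `ι_* Z` of a tangent field) that is
differentiable at `y`: `⟪y, dF_y v⟫ = -⟪dι_y v, F y⟫` — differentiate `⟪y, F y⟫ = 0` along `v`.
This is the Weingarten equation for the outward unit normal `N = y` of the unit sphere, whose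
shape operator is `-Id` (Lee 2018, Example 8.25, `s = (-1/R) Id` with `R = 1`).
[cite: Lee2018, Example 8.25] -/
theorem inner_coe_mvfderiv_lift_sphere {F : sphere (0 : V) 1 → V}
    (hF : ∀ y : sphere (0 : V) 1, ⟪(y : V), F y⟫ = 0) {y : sphere (0 : V) 1}
    (hFd : MDifferentiableAt (𝓡 n) 𝓘(ℝ, V) F y) (v : TangentSpace (𝓡 n) y) :
    ⟪(y : V), mvfderiv (𝓡 n) F y v⟫ = -⟪dι[y] v, F y⟫ := by
  have hc : MDifferentiableAt (𝓡 n) 𝓘(ℝ, V) (Subtype.val : sphere (0 : V) 1 → V) y :=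
    ((contMDiff_coe_sphere (E := V) (m := 1)) y).mdifferentiableAt one_ne_zero
  have h1 := mvfderiv_inner_apply (I := 𝓡 n) hc hFd v
  have h2 : mvfderiv (𝓡 n) (fun y' : sphere (0 : V) 1 ↦ ⟪(y' : V), F y'⟫) y =
      mvfderiv (𝓡 n) (fun _ : sphere (0 : V) 1 ↦ (0 : ℝ)) y :=
    mvfderiv_congr_nhds (Filter.Eventually.of_forall fun y' ↦ hF y')
  rw [h2, mvfderiv_const, zero_apply] at h1
  linarith

/-- **Second covariant derivatives on the round sphere, paired with a tangent vector.** For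
`cov` torsion-free and compatible with the round metric, `Y` of class `C²` and `Z` of class `C³`
on an open set `u ∋ x`, and `X₀, W₀ ∈ T_x Sⁿ`:
`g(∇_{X₀} (∇_Y Z), W₀) = ⟪d(y ↦ d(ι_* Z)_y (Y y))_x X₀, dι W₀⟫ + g(Y, Z)(x) g(X₀, W₀)`. Indeed
`ι_*(∇_Y Z) = D_Y(ι_* Z) + ⟪ι_* Y, ι_* Z⟫ y` near `x` (`mvfderiv_coe_cov_apply_sphere` with the
normal component `inner_coe_mvfderiv_lift_sphere`, i.e. the Gauss formula
`∇̄_Y Z = ∇_Y Z + h(Y,Z) N` with `h = -g` for the outward normal of the unit sphere, Lee 2018,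
Example 8.25 and Thm. 8.13), then the tangential Gauss formula once more for `∇_{X₀}`; the term
through the position vector `y` is orthogonal to `dι W₀`. This is the hypersurface-specific half
of the Gauss equation (Lee 2018, Thm. 8.5) for the sphere. [cite: Lee2018, Example 8.25 and Thm. 8.5] -/
theorem val_cov_cov_apply_sphere
    {cov : CovariantDerivative (𝓡 n) (EuclideanSpace ℝ (Fin n))
      (TangentSpace (𝓡 n) : sphere (0 : V) 1 → Type _)}
    (h : (roundMetric (n := n) V).IsLeviCivita cov) {x : sphere (0 : V) 1}
    {u : Set (sphere (0 : V) 1)} (hu : IsOpen u) (hxu : x ∈ u)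
    {Y Z : Π y : sphere (0 : V) 1, TangentSpace (𝓡 n) y} (hY : CMDiff[u] 2 (T% Y))
    (hZ : CMDiff[u] 3 (T% Z)) (X₀ W₀ : TangentSpace (𝓡 n) x) :
    (roundMetric (n := n) V).val x (cov (fun y ↦ cov Z y (Y y)) x X₀) W₀ =
      ⟪mvfderiv (𝓡 n) (fun y ↦ mvfderiv (𝓡 n) (fun y' ↦ dι[y'] (Z y')) y (Y y)) x X₀, dι[x] W₀⟫
        + ⟪dι[x] (Y x), dι[x] (Z x)⟫ * ⟪dι[x] X₀, dι[x] W₀⟫ := by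
  have hnh : ∀ {y}, y ∈ u → u ∈ 𝓝 y := fun hy ↦ hu.mem_nhds hy
  have h23 : (2 : ℕ∞ω) ≤ 3 := by norm_num
  have h12 : (1 : ℕ∞ω) ≤ 2 := by norm_num
  -- regularity of `cov`: locally `C²`
  have hreg2 : cov.IsLocallyContMDiff 2 := h.isLocallyContMDiff 2 (by exact_mod_cast le_top)
  -- the second-order field `∇_Y Z` is `C²` on `u`
  set U : Π y : sphere (0 : V) 1, TangentSpace (𝓡 n) y := fun y ↦ cov Z y (Y y) with hUdef
  have hTZ : ContMDiffOn (𝓡 n) ((𝓡 n).prod 𝓘(ℝ, EuclideanSpace ℝ (Fin n) →L[ℝ]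
      EuclideanSpace ℝ (Fin n))) 2 (cov.totalCovDeriv Z) u := (hreg2 u hu).contMDiff hZ
  have hU2 : CMDiff[u] 2 (T% U) := hTZ.clm_bundle_apply hY
  have hUx : CMDiffAt 2 (T% U) x := (hU2 x hxu).contMDiffAt (hnh hxu)
  -- pointwise regularity on `u`
  have hY2 : ∀ {y}, y ∈ u → CMDiffAt 2 (T% Y) y := fun hy ↦ (hY _ hy).contMDiffAt (hnh hy)
  have hZ2 : ∀ {y}, y ∈ u → CMDiffAt 2 (T% Z) y := fun hy ↦
    ((hZ _ hy).contMDiffAt (hnh hy)).of_le h23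
  -- the lifts `ι_* Y`, `ι_* Z` and their regularity
  set LY : sphere (0 : V) 1 → V := fun y ↦ dι[y] (Y y) with hLYdef
  set LZ : sphere (0 : V) 1 → V := fun y ↦ dι[y] (Z y) with hLZdef
  have hLZ2 : ∀ {y}, y ∈ u → ContMDiffAt (𝓡 n) 𝓘(ℝ, V) 2 LZ y := fun hy ↦
    VectorField.contMDiffAt_mvfderiv_apply_of_contMDiffAt (contMDiff_coe_sphere (m := 3) _)
      (hZ2 hy) (by norm_num)
  have hLZd : ∀ {y}, y ∈ u → MDifferentiableAt (𝓡 n) 𝓘(ℝ, V) LZ y := fun hy ↦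
    (hLZ2 hy).mdifferentiableAt two_ne_zero
  have hLYd : MDifferentiableAt (𝓡 n) 𝓘(ℝ, V) LY x :=
    (VectorField.contMDiffAt_mvfderiv_apply_of_contMDiffAt (contMDiff_coe_sphere (m := 2) _)
      ((hY2 hxu).of_le h12) (by norm_num)).mdifferentiableAt one_ne_zero
  -- `G y := d(ι_* Z)_y (Y y)` is differentiable at `x`
  set G : sphere (0 : V) 1 → V := fun y ↦ mvfderiv (𝓡 n) LZ y (Y y) with hGdef
  have hGd : MDifferentiableAt (𝓡 n) 𝓘(ℝ, V) G x :=
    (VectorField.contMDiffAt_mvfderiv_apply_of_contMDiffAt (hLZ2 hxu) ((hY2 hxu).of_le h12)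
      (by norm_num)).mdifferentiableAt one_ne_zero
  -- `φ := ⟪ι_* Y, ι_* Z⟫` and the inclusion are differentiable at `x`
  set φ : sphere (0 : V) 1 → ℝ := fun y ↦ ⟪LY y, LZ y⟫ with hφdef
  have hφd : MDifferentiableAt (𝓡 n) 𝓘(ℝ, ℝ) φ x := mdifferentiableAt_inner hLYd (hLZd hxu)
  have hcd : MDifferentiableAt (𝓡 n) 𝓘(ℝ, V) (Subtype.val : sphere (0 : V) 1 → V) x :=
    ((contMDiff_coe_sphere (E := V) (m := 1)) x).mdifferentiableAt one_ne_zero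
  -- the lift of `∇_Y Z` on `u`: `dι(∇_Y Z) = D_Y(ι_* Z) + ⟪ι_* Y, ι_* Z⟫ y`
  have hlift : (fun y ↦ dι[y] (U y)) =ᶠ[𝓝 x] G + φ • (Subtype.val : sphere (0 : V) 1 → V) := by
    filter_upwards [hnh hxu] with y hy
    have h1 := mvfderiv_coe_cov_apply_sphere h (hZ2 hy) (Y y)
    have h2 := inner_coe_mvfderiv_lift_sphere (n := n) (F := LZ)
      (fun y' ↦ inner_coe_mvfderiv_coe_sphere y' (Z y')) (hLZd hy) (Y y)
    simp only [hUdef, Pi.add_apply, Pi.smul_apply', hGdef, hφdef, hLYdef]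
    rw [h1, h2, neg_smul, sub_neg_eq_add]
  -- the tangential Gauss formula for `∇_{X₀} (∇_Y Z)`, and the product rules at `x`
  have hA := h.inner_mvfderiv_cov_apply contMDiff_coe_sphere
    (roundMetric_val_eq_inner (n := n)) hUx X₀ W₀
  rw [roundMetric_val_eq_inner, hA, mvfderiv_congr_nhds hlift, mvfderiv_add hGd (hφd.smul hcd),
    mvfderiv_smul hφd hcd]
  simp only [add_apply, smul_apply, ContinuousLinearMap.smulRight_apply, inner_add_left,
    real_inner_smul_left, inner_coe_mvfderiv_coe_sphere x W₀, mul_zero, add_zero]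
  rfl

/-! ## Constant curvature and the Ricci tensor -/

/-- **The round unit sphere has constant curvature `1`:** for every torsion-free covariant
derivative `cov` compatible with the round metric `g`, every `x ∈ Sⁿ` and `X₀, Y₀, Z₀ ∈ T_x Sⁿ`,
`R(X₀, Y₀)Z₀ = g(Y₀, Z₀) X₀ - g(X₀, Z₀) Y₀`
(`R(X,Y)Z = ∇_X ∇_Y Z - ∇_Y ∇_X Z - ∇_{[X,Y]} Z`, `CovariantDerivative.curvature`). Lee 2018,
Thm. 8.34 (b) (the unit sphere has constant sectional curvature `1`) in the form of Prop. 8.36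
(`R(v, w)x = c(⟨w, x⟩v - ⟨v, x⟩w)` for constant curvature `c`). Proof (the Gauss equation,
Lee 2018, Thm. 8.5, for this hypersurface): evaluate the curvature tensor on smooth local
extensions `X, Y, Z` (`CovariantDerivative.curvature_apply_of_isLocallyContMDiff`; `cov` is
locally `C¹`, `IsLeviCivita.isLocallyContMDiff_one`), pair with `dι W₀` (nondegeneracy of `g`),
expand the two second-order terms by `val_cov_cov_apply_sphere` and the bracket term by the
tangential Gauss formula and `mvfderiv_apply_mlieBracket_vec` applied to `ι_* Z`; the ambient
second derivatives cancel and `g(Y,Z) g(X,W) - g(X,Z) g(Y,W)` remains.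
[cite: Lee2018, Thm. 8.34 (b) and Prop. 8.36] -/
theorem curvature_roundMetric
    {cov : CovariantDerivative (𝓡 n) (EuclideanSpace ℝ (Fin n))
      (TangentSpace (𝓡 n) : sphere (0 : V) 1 → Type _)}
    (h : (roundMetric (n := n) V).IsLeviCivita cov) (x : sphere (0 : V) 1)
    (X₀ Y₀ Z₀ : TangentSpace (𝓡 n) x) :
    cov.curvature x X₀ Y₀ Z₀ =
      (roundMetric (n := n) V).val x Y₀ Z₀ • X₀ - (roundMetric (n := n) V).val x X₀ Z₀ • Y₀ := by
  have hI3 : IsManifold (𝓡 n) (minSmoothness ℝ 3) (sphere (0 : V) 1) := by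
    rw [minSmoothness_of_isRCLikeNormedField]; infer_instance
  have h2m : minSmoothness ℝ 2 = 2 := minSmoothness_of_isRCLikeNormedField
  have h2i : (2 : ℕ∞ω) ≤ ∞ := WithTop.coe_le_coe.mpr le_top
  have h3i : (3 : ℕ∞ω) ≤ ∞ := WithTop.coe_le_coe.mpr le_top
  have h23 : (2 : ℕ∞ω) ≤ 3 := by norm_num
  -- smooth local extensions of the three vectors, on a common open set `u ∋ x`
  obtain ⟨uX, huX, hxX, hXs⟩ := exists_isOpen_contMDiffOn_extend_infty (I := 𝓡 n) X₀
  obtain ⟨uY, huY, hxY, hYs⟩ := exists_isOpen_contMDiffOn_extend_infty (I := 𝓡 n) Y₀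
  obtain ⟨uZ, huZ, hxZ, hZs⟩ := exists_isOpen_contMDiffOn_extend_infty (I := 𝓡 n) Z₀
  set X : Π y : sphere (0 : V) 1, TangentSpace (𝓡 n) y :=
    extend (EuclideanSpace ℝ (Fin n)) X₀ with hXdef
  set Y : Π y : sphere (0 : V) 1, TangentSpace (𝓡 n) y :=
    extend (EuclideanSpace ℝ (Fin n)) Y₀ with hYdef
  set Z : Π y : sphere (0 : V) 1, TangentSpace (𝓡 n) y :=
    extend (EuclideanSpace ℝ (Fin n)) Z₀ with hZdef
  set u : Set (sphere (0 : V) 1) := uX ∩ uY ∩ uZ with hudef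
  have hu : IsOpen u := (huX.inter huY).inter huZ
  have hxu : x ∈ u := ⟨⟨hxX, hxY⟩, hxZ⟩
  have hnh : u ∈ 𝓝 x := hu.mem_nhds hxu
  have hX2 : CMDiff[u] 2 (T% X) := (hXs.of_le h2i).mono fun y hy ↦ hy.1.1
  have hY2 : CMDiff[u] 2 (T% Y) := (hYs.of_le h2i).mono fun y hy ↦ hy.1.2
  have hZ3 : CMDiff[u] 3 (T% Z) := (hZs.of_le h3i).mono fun y hy ↦ hy.2
  have hXx2 : CMDiffAt 2 (T% X) x := (hX2 x hxu).contMDiffAt hnh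
  have hYx2 : CMDiffAt 2 (T% Y) x := (hY2 x hxu).contMDiffAt hnh
  have hZx2 : CMDiffAt 2 (T% Z) x := ((hZ3 x hxu).contMDiffAt hnh).of_le h23
  have hXx : X x = X₀ := extend_apply_self _ X₀
  have hYx : Y x = Y₀ := extend_apply_self _ Y₀
  have hZx : Z x = Z₀ := extend_apply_self _ Z₀
  -- Step 1: the curvature tensor is computed on the extensions
  have hreg1 : cov.IsLocallyContMDiff 1 := h.isLocallyContMDiff_one h2i
  have e1 : cov.curvature x X₀ Y₀ Z₀ = CovariantDerivative.curvatureAux cov X Y Z x := by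
    have hZm : CMDiffAt (minSmoothness ℝ 2) (T% Z) x := by rw [h2m]; exact hZx2
    have := cov.curvature_apply_of_isLocallyContMDiff hreg1 (hXx2.mdifferentiableAt two_ne_zero)
      (hYx2.mdifferentiableAt two_ne_zero) hZm
    rwa [hXx, hYx, hZx] at this
  -- Step 2: pair with an arbitrary tangent vector `W₀` (nondegeneracy of `g`)
  refine sub_eq_zero.1 ((roundMetric (n := n) V).nondegenerate x _ fun W₀ ↦ ?_)
  rw [map_sub, sub_apply, sub_eq_zero, e1]
  simp only [CovariantDerivative.curvatureAux, map_sub, sub_apply, hXx, hYx]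
  -- Step 3: the two second-order terms
  rw [val_cov_cov_apply_sphere h hu hxu hY2 hZ3 X₀ W₀,
    val_cov_cov_apply_sphere h hu hxu hX2 hZ3 Y₀ W₀]
  -- Step 4: the bracket term
  have hLZ2 : ContMDiffAt (𝓡 n) 𝓘(ℝ, V) 2 (fun y ↦ dι[y] (Z y)) x :=
    VectorField.contMDiffAt_mvfderiv_apply_of_contMDiffAt (contMDiff_coe_sphere (m := 3) _)
      hZx2 (by norm_num)
  have hA := h.inner_mvfderiv_cov_apply contMDiff_coe_sphere
    (roundMetric_val_eq_inner (n := n)) hZx2 (mlieBracket (𝓡 n) X Y x) W₀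
  have hB := mvfderiv_apply_mlieBracket_vec (I := 𝓡 n) hLZ2 hXx2 hYx2
  rw [hXx, hYx] at hB
  have h3 : (roundMetric (n := n) V).val x (cov Z x (mlieBracket (𝓡 n) X Y x)) W₀ =
      ⟪mvfderiv (𝓡 n) (fun y ↦ mvfderiv (𝓡 n) (fun y' ↦ dι[y'] (Z y')) y (Y y)) x X₀, dι[x] W₀⟫
        - ⟪mvfderiv (𝓡 n) (fun y ↦ mvfderiv (𝓡 n) (fun y' ↦ dι[y'] (Z y')) y (X y)) x Y₀,
          dι[x] W₀⟫ := by
    rw [roundMetric_val_eq_inner x (cov Z x _) W₀, hA, hB, inner_sub_left]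
  rw [h3]
  -- Step 5: collect
  simp only [map_smul, FunLike.coe_smul, Pi.smul_apply, smul_eq_mul, roundMetric_val_eq_inner,
    hXx, hYx, hZx]
  ring

/-- **The round unit sphere is Einstein with constant `n - 1`** — discharge of the named fact
`ricci_roundMetric` (Topping 2006, §1.2.1: "for the round 'unit' sphere `(Sⁿ, g₀)`, we have
`Ric(g₀) = (n-1)g₀`"). For every torsion-free `cov` compatible with the round metric,
`Ric(X₀, Y₀) = tr (v ↦ R(v, X₀) Y₀) = tr (v ↦ g(X₀, Y₀) v - g(v, Y₀) X₀) = n g(X₀, Y₀) - g(X₀, Y₀)`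
by `curvature_roundMetric` (Lee 2018, Prop. 8.36: `Rc = (n-1) c g` for constant curvature `c`;
`dim T_y Sⁿ = n`, `LinearMap.trace_id`, `LinearMap.trace_smulRight`). [cite: Topping2006, §1.2.1] -/
theorem ricci_roundMetric_holds : ricci_roundMetric := by
  intro V _ _ n _ cov hcov y v w
  haveI : FiniteDimensional ℝ (TangentSpace (𝓡 n) y) :=
    inferInstanceAs (FiniteDimensional ℝ (EuclideanSpace ℝ (Fin n)))
  set ℓ : TangentSpace (𝓡 n) y →ₗ[ℝ] ℝ := ((roundMetric (n := n) V).toBilinForm y).flip w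
    with hℓ
  have hR : cov.ricciAux y v w =
      (roundMetric (n := n) V).val y v w • LinearMap.id - ℓ.smulRight v := by
    ext z
    simp [hℓ, CovariantDerivative.ricciAux_apply, curvature_roundMetric hcov y z v w]
  rw [CovariantDerivative.ricci_apply, hR, map_sub, map_smul, LinearMap.trace_id,
    LinearMap.trace_smulRight]
  have hn : (finrank ℝ (TangentSpace (𝓡 n) y) : ℝ) = n := by
    rw [show finrank ℝ (TangentSpace (𝓡 n) y) = finrank ℝ (EuclideanSpace ℝ (Fin n)) from rfl,
      finrank_euclideanSpace_fin]
  have hℓv : ℓ v = (roundMetric (n := n) V).val y v w := rfl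
  rw [hn, hℓv, smul_eq_mul]
  ring

end Literature.Geometry.Riemannian

end
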